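import Summits.SmoothPoincare4.SmoothPoincare4.Theses.SymplecticOrigami
import Summits.SmoothPoincare4.SmoothPoincare4.Theses.SymplecticCap
import Literature.Geometry.Symplectic.AlmostComplexStructure
import Literature.Geometry.Symplectic.GromovR4RelEnd
import Summits.SmoothPoincare4.SmoothPoincare4.Theorems.SymplecticOrigamiGromovRecognitionRelEndStubReadSigmaAux3
import Summits.SmoothPoincare4.SmoothPoincare4.Theorems.SymplecticOrigamiGromovRecognitionRelEndStubReadSigmaAux4

/-!
# Line `cross-cap-laurent`, Stub 4e (`stub_readSigma`): reading the bi-foliation chart `σ` on `M`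
(crux `SymplecticOrigami.GromovRecognitionRelEnd` ≡ `SymplecticCap.GromovRecognitionRelEnd`,
item stmt-SmoothPoincare4-11009)

Proves `stub_readSigma` (statement verbatim from the skeleton of the line).  Construction in
`…StubReadSigmaAux1` (inverse of an injective local diffeomorphism), `…Aux2` (hypotheses bundled as
`ReadSigma.SigmaHyp`, inverse cap charts `θH`, `θV`, the chart `σf = (z₁∘θH∘lamV∘ι, z₂∘θV∘lamH∘ι)`),
`…Aux3` (`σf` bijective with injective differential ⇒ diffeomorphism `σ : M ≃ₘ ℝ⁴`), `…Aux4`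
((B3)–(B5)).  Here: holomorphy of the inverse charts, (B2) TAME (positive holonomy read where
`JX = i ⊕ i`), (B1) SPLIT (`JX`-invariant kernels), and the assembly.  References: Gromov, Invent.
Math. 82 (1985), §0.3.C; McDuff–Salamon (2017), Rem. 4.5.2 (viii); Lee (2013), Thm. 4.5, Prop. 4.22.
-/


noncomputable section

-- the prescribed namespace `Summit.<P>.<Sub>.…` duplicates `SmoothPoincare4` (P = Sub)
set_option linter.dupNamespace false

open scoped Manifold ContDiff Topology
open Set TopologicalSpace Literature.Geometry.Kaehler Literature.Geometry.Symplectic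

namespace Summit.SmoothPoincare4.SmoothPoincare4.Theorems.GromovRecognitionRelEnd.CrossCapLaurent

/-- Model space `ℝ⁴ = ℂ²` (coordinates `0,1` = `z₁`, `2,3` = `z₂`). -/
local notation "E4" => EuclideanSpace ℝ (Fin 4)
/-- `ℝ² = ℂ`, the coordinate plane of one factor. -/
local notation "E2" => EuclideanSpace ℝ (Fin 2)

namespace ReadSigma

open CapModel

variable {M X : Type*} [TopologicalSpace M] [ChartedSpace E4 M] [IsManifold (𝓡 4) ∞ M]
  [TopologicalSpace X] [ChartedSpace E4 X] [IsManifold (𝓡 4) ∞ X]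
  {J : AlmostComplexStructure (𝓡 4) ∞ M} {JX : AlmostComplexStructure (𝓡 4) ∞ X}
  {ι : M → X} {ηH ηV ηC : E4 → X} {χ : E4 → M} {R₁ : ℝ} {lamV lamH : X → X}

namespace SigmaHyp

variable (h : SigmaHyp J JX ι ηH ηV ηC χ R₁ lamV lamH)
include h

/-! ## Holomorphy of the inverse charts -/

/-- **`θH` is holomorphic at the points `lamV y`** (`y` off `V∞`): `dθH ∘ JX = I4 ∘ dθH`. [folklore] -/
theorem dθH_J {y : X} (hV : lamV y ≠ ηC 0) :
    ∀ ξ : TangentSpace (𝓡 4) (lamV y),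
      mfderiv (𝓡 4) 𝓘(ℝ, E4) (θH ηH R₁) (lamV y) (JX (lamV y) ξ) =
        I4 (mfderiv (𝓡 4) 𝓘(ℝ, E4) (θH ηH R₁) (lamV y) ξ) := by
  obtain ⟨p, h2, h3, hp⟩ := h.labelV hV
  rw [← hp]
  intro ξ
  have hpD := h.mem_DH_of_axis h2 h3
  exact mfderiv_invFunOn_conj h.ηH_locDiff (isOpen_DH R₁) h.ηH_inj (by simp) hpD I4 (JX (ηH p))
    (fun q => h.ηH_J p hpD q) ξ

/-- **`θV` is holomorphic at the points `lamH y`** (`y` off `H∞`). [folklore] -/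
theorem dθV_J {y : X} (hH : lamH y ≠ ηC 0) :
    ∀ ξ : TangentSpace (𝓡 4) (lamH y),
      mfderiv (𝓡 4) 𝓘(ℝ, E4) (θV ηV R₁) (lamH y) (JX (lamH y) ξ) =
        I4 (mfderiv (𝓡 4) 𝓘(ℝ, E4) (θV ηV R₁) (lamH y) ξ) := by
  obtain ⟨q, h0, h1, hq⟩ := h.labelH hH
  rw [← hq]
  intro ξ
  have hqD := h.mem_DV_of_axis h0 h1
  exact mfderiv_invFunOn_conj h.ηV_locDiff (isOpen_DV R₁) h.ηV_inj (by simp) hqD I4 (JX (ηV q))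
    (fun q' => h.ηV_J q hqD q') ξ

/-! ## (B2): positive holonomy read in the charts -/

/-- **The `z₁`-area of the `V`-labels of `u`, `JX u` is `≥ 0`, and `> 0` unless `d lamV u = 0`**:
`A' = dθH (d lamV (JX u)) = α A + β I4 A`, `A = dθH (d lamV u)`, so the area is `β (A₀² + A₁²)`. [folklore] -/
theorem areaV [T2Space X] {y : X} (hV : lamV y ≠ ηC 0) (u : TangentSpace (𝓡 4) y) :
    0 ≤ (dlabV ηH R₁ lamV y u) 0 * (dlabV ηH R₁ lamV y (JX y u)) 1 -
        (dlabV ηH R₁ lamV y u) 1 * (dlabV ηH R₁ lamV y (JX y u)) 0 ∧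
    (mfderiv (𝓡 4) (𝓡 4) lamV y u ≠ 0 →
      0 < (dlabV ηH R₁ lamV y u) 0 * (dlabV ηH R₁ lamV y (JX y u)) 1 -
        (dlabV ηH R₁ lamV y u) 1 * (dlabV ηH R₁ lamV y (JX y u)) 0) := by
  set T := mfderiv (𝓡 4) 𝓘(ℝ, E4) (θH ηH R₁) (lamV y) with hT
  set ξ := mfderiv (𝓡 4) (𝓡 4) lamV y u with hξ
  by_cases h0 : ξ = 0
  · have h1 : mfderiv (𝓡 4) (𝓡 4) lamV y (JX y u) = 0 := h.kerV y u h0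
    have hA : dlabV ηH R₁ lamV y u = 0 := by
      show T ξ = 0
      rw [h0]; exact map_zero T
    have hA' : dlabV ηH R₁ lamV y (JX y u) = 0 := by
      show T (mfderiv (𝓡 4) (𝓡 4) lamV y (JX y u)) = 0
      rw [h1]; exact map_zero T
    rw [hA, hA']
    simp [h0]
  · obtain ⟨α, β, hβ, hhol⟩ := h.holV y u h0
    have e2 : T (mfderiv (𝓡 4) (𝓡 4) lamV y (JX y u)) = α • T ξ + β • T (JX (lamV y) ξ) := by
      rw [hhol, map_add, map_smul, map_smul]
    rw [h.dθH_J hV ξ] at e2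
    have hA' : dlabV ηH R₁ lamV y (JX y u) =
        α • dlabV ηH R₁ lamV y u + β • I4 (dlabV ηH R₁ lamV y u) := e2
    have hne : dlabV ηH R₁ lamV y u ≠ 0 := fun hz => h0 (h.dθH_eq_zero hV ξ hz)
    have hpos := sq01_pos hne (h.P23_dlabV hV u)
    rw [area01_of_hol _ _ α β hA']
    exact ⟨(mul_pos hβ hpos).le, fun _ => mul_pos hβ hpos⟩

/-- **The `z₂`-area of the `H`-labels of `u`, `JX u` is `≥ 0`, `> 0` unless `d lamH u = 0`.** [folklore] -/
theorem areaH [T2Space X] {y : X} (hH : lamH y ≠ ηC 0) (u : TangentSpace (𝓡 4) y) :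
    0 ≤ (dlabH ηV R₁ lamH y u) 2 * (dlabH ηV R₁ lamH y (JX y u)) 3 -
        (dlabH ηV R₁ lamH y u) 3 * (dlabH ηV R₁ lamH y (JX y u)) 2 ∧
    (mfderiv (𝓡 4) (𝓡 4) lamH y u ≠ 0 →
      0 < (dlabH ηV R₁ lamH y u) 2 * (dlabH ηV R₁ lamH y (JX y u)) 3 -
        (dlabH ηV R₁ lamH y u) 3 * (dlabH ηV R₁ lamH y (JX y u)) 2) := by
  set T := mfderiv (𝓡 4) 𝓘(ℝ, E4) (θV ηV R₁) (lamH y) with hT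
  set ξ := mfderiv (𝓡 4) (𝓡 4) lamH y u with hξ
  by_cases h0 : ξ = 0
  · have h1 : mfderiv (𝓡 4) (𝓡 4) lamH y (JX y u) = 0 := h.kerH y u h0
    have hB : dlabH ηV R₁ lamH y u = 0 := by
      show T ξ = 0
      rw [h0]; exact map_zero T
    have hB' : dlabH ηV R₁ lamH y (JX y u) = 0 := by
      show T (mfderiv (𝓡 4) (𝓡 4) lamH y (JX y u)) = 0
      rw [h1]; exact map_zero T
    rw [hB, hB']
    simp [h0]
  · obtain ⟨α, β, hβ, hhol⟩ := h.holH y u h0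
    have e2 : T (mfderiv (𝓡 4) (𝓡 4) lamH y (JX y u)) = α • T ξ + β • T (JX (lamH y) ξ) := by
      rw [hhol, map_add, map_smul, map_smul]
    rw [h.dθV_J hH ξ] at e2
    have hB' : dlabH ηV R₁ lamH y (JX y u) =
        α • dlabH ηV R₁ lamH y u + β • I4 (dlabH ηV R₁ lamH y u) := e2
    have hne : dlabH ηV R₁ lamH y u ≠ 0 := fun hz => h0 (h.dθV_eq_zero hH ξ hz)
    have hpos := sq23_pos hne (h.P01_dlabH hH u)
    rw [area23_of_hol _ _ α β hB']
    exact ⟨(mul_pos hβ hpos).le, fun _ => mul_pos hβ hpos⟩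

/-- **(B2) TAME**: `ω₀ (dσf v, dσf (J v)) > 0` for `v ≠ 0`. [cite: Gromov1985, §0.3.C] -/
theorem tame [T2Space X] (x : M) (v : TangentSpace (𝓡 4) x) (hv : v ≠ 0) :
    0 < stdSymplecticForm (mfderiv (𝓡 4) 𝓘(ℝ, E4) (σf ι ηH ηV R₁ lamV lamH) x v)
      (mfderiv (𝓡 4) 𝓘(ℝ, E4) (σf ι ηH ηV R₁ lamV lamH) x (J x v)) := by
  rw [h.mfderiv_σf_apply, h.mfderiv_σf_apply, ← h.ι_J x v, stdSymplecticForm_P01_P23]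
  set u := mfderiv (𝓡 4) (𝓡 4) ι x v with hu
  obtain ⟨hV0, hVpos⟩ := h.areaV (h.lamV_ι_ne x) u
  obtain ⟨hH0, hHpos⟩ := h.areaH (h.lamH_ι_ne x) u
  have hu0 : u ≠ 0 := fun hz => hv (h.dι_eq_zero x hz)
  by_cases hVu : mfderiv (𝓡 4) (𝓡 4) lamV (ι x) u = 0
  · have hHu : mfderiv (𝓡 4) (𝓡 4) lamH (ι x) u ≠ 0 := fun hz => hu0 (h.trans _ u hVu hz)
    have := hHpos hHu
    linarith
  · have := hVpos hVu
    linarith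

/-! ## (B1): the coordinate planes of `dσ` are `J`-complex -/

/-- **(B1) SPLIT**: with `a = dσf v`, `b = dσf (J v)`: `a₂ = a₃ = 0 ⇒ b₂ = b₃ = 0` and
`a₀ = a₁ = 0 ⇒ b₀ = b₁ = 0`. [cite: Gromov1985, §0.3.C] -/
theorem split [T2Space X] (x : M) (v : TangentSpace (𝓡 4) x) (a b : E4)
    (ha : a = mfderiv (𝓡 4) 𝓘(ℝ, E4) (σf ι ηH ηV R₁ lamV lamH) x v)
    (hb : b = mfderiv (𝓡 4) 𝓘(ℝ, E4) (σf ι ηH ηV R₁ lamV lamH) x (J x v)) :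
    (a 2 = 0 → a 3 = 0 → b 2 = 0 ∧ b 3 = 0) ∧ (a 0 = 0 → a 1 = 0 → b 0 = 0 ∧ b 1 = 0) := by
  rw [h.mfderiv_σf_apply] at ha
  rw [h.mfderiv_σf_apply, ← h.ι_J x v] at hb
  set u := mfderiv (𝓡 4) (𝓡 4) ι x v with hu
  set A : E4 := dlabV ηH R₁ lamV (ι x) u
  set A' : E4 := dlabV ηH R₁ lamV (ι x) (JX (ι x) u)
  set B : E4 := dlabH ηV R₁ lamH (ι x) u
  set B' : E4 := dlabH ηV R₁ lamH (ι x) (JX (ι x) u)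
  obtain ⟨c0, c1, c2, c3⟩ := P01_add_P23_apply A B
  obtain ⟨d0, d1, d2, d3⟩ := P01_add_P23_apply A' B'
  subst ha hb
  constructor
  · intro h2 h3
    rw [c2] at h2
    rw [c3] at h3
    have hB : B = 0 :=
      eq_zero_of_P01_P23 (h.P01_dlabH (h.lamH_ι_ne x) u) ((P23_eq_zero_iff B).2 ⟨h2, h3⟩)
    have hlam : mfderiv (𝓡 4) (𝓡 4) lamH (ι x) u = 0 := h.dθV_eq_zero (h.lamH_ι_ne x) _ hB
    have hB' : B' = 0 := by
      show mfderiv (𝓡 4) 𝓘(ℝ, E4) (θV ηV R₁) (lamH (ι x))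
        (mfderiv (𝓡 4) (𝓡 4) lamH (ι x) (JX (ι x) u)) = 0
      rw [h.kerH _ u hlam]
      exact map_zero _
    rw [d2, d3, hB']
    simp
  · intro h0 h1
    rw [c0] at h0
    rw [c1] at h1
    have hA : A = 0 :=
      eq_zero_of_P01_P23 ((P01_eq_zero_iff A).2 ⟨h0, h1⟩) (h.P23_dlabV (h.lamV_ι_ne x) u)
    have hlam : mfderiv (𝓡 4) (𝓡 4) lamV (ι x) u = 0 := h.dθH_eq_zero (h.lamV_ι_ne x) _ hA
    have hA' : A' = 0 := by
      show mfderiv (𝓡 4) 𝓘(ℝ, E4) (θH ηH R₁) (lamV (ι x))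
        (mfderiv (𝓡 4) (𝓡 4) lamV (ι x) (JX (ι x) u)) = 0
      rw [h.kerV _ u hlam]
      exact map_zero _
    rw [d0, d1, hA']
    simp

end SigmaHyp

end ReadSigma

/-- **Stub 4e — reading the bi-foliation chart `σ` on `M` (L; Gromov 1985 §0.3.C "coordinates", MS2017
Rem. 4.5.2 (viii) "two families of embedded holomorphic curves that can be used as coordinates for a
diffeomorphism to ℝ⁴").**  From the cap block, the two retractions with all properties of
`stub_biFoliationCore`, the wedge facts of `stub_wedgeDisjoint` and the flat-leaf identities of
`stub_flatLeaves`, the map `σ x := (z₁(ηH⁻¹ (lamV (ι x))), z₂(ηV⁻¹ (lamH (ι x))))` — labels of the two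
leaves through `ι x` read in the cap charts (`lamV (ι x) ≠ ηC 0` because `ι x ∉ V∞`) — is a diffeomorphism
`M ≃ₘ ℝ⁴` with the apex properties (B1)–(B5).  Proof plan: smooth (compositions; `ηH⁻¹`, `ηV⁻¹` smooth on
the chart images); injective (`hinj` + `ι` injective); surjective (`hsurj` gives `y` with prescribed affine
labels; `y ∉ H∞ ∪ V∞` by the wedge facts, hence `y ∈ range ι` by the cover clause); `dσ` injective
(`htr` + `dι` injective), so `σ` is a bijective local diffeomorphism, packaged as `Diffeomorph`
(landed pattern in `StubFlatCutoff`); (B1) `a₂ = a₃ = 0 ⇔ d lamH (dι v) = 0` ⇒ (`hJH`, `ι` holomorphic)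
`d lamH (dι (J v)) = 0 ⇒ b₂ = b₃ = 0`, and symmetrically; (B2) in the `ηH`-chart `JX|TH∞ = i`, so positive
holonomy reads `a₀ b₁ − a₁ b₀ = β (a₀² + a₁²) ≥ 0`, same for `23`, and both vanish only if
`d lamV (dι v) = d lamH (dι v) = 0`, i.e. `v = 0` (`htr`) — this is `tameSplit`; (B3a/b) are `hfV`/`hfH`
read through the charts; (B4) `g p := z₂(ηV⁻¹ (lamH (ηV p)))` is smooth on `{p₀² + p₁² < R₁⁻²}` (needs
`lamH (ηV p) ≠ ηC 0`, i.e. `ηV p ∉ H∞`: wedge facts on the axis, `range ι ∩ H∞ = ∅` off it), equals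
`σ₂₃ (χ (1/u, z₂))` for `u ≠ 0` (cap clause `ηV (u, z₂) = ι χ (1/u, z₂)`) and `z₂` on the axis (`lamH` is the
identity on `V∞`); (B5) symmetric.  Leans on: cap block, landed chart calculus and smooth-inverse /
`Diffeomorph` packaging lemmas of `StubCapModel*`, `StubFlatCutoff*`; `stdSymplecticForm`. [cite: Gromov1985, §0.3.C] -/
theorem stub_readSigma :
    ∀ (M : Type) [TopologicalSpace M] [T2Space M] [SecondCountableTopology M]
      [ChartedSpace E4 M] [IsManifold (𝓡 4) ∞ M] [ConnectedSpace M]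
      (J : AlmostComplexStructure (𝓡 4) ∞ M) (K : Set M) (R R₁ : ℝ) (ψ : M → E4) (χ : E4 → M),
      ContMDiffOn (𝓡 4) 𝓘(ℝ, E4) ∞ ψ Kᶜ →
      ContMDiffOn 𝓘(ℝ, E4) (𝓡 4) ∞ χ (Metric.closedBall (0 : E4) R)ᶜ →
      Set.BijOn ψ Kᶜ (Metric.closedBall (0 : E4) R)ᶜ →
      (∀ x, x ∈ Kᶜ → χ (ψ x) = x) →
      R < R₁ → 0 < R₁ →
      (∀ x, x ∈ Kᶜ → R₁ < ‖ψ x‖ → ∀ (v : TangentSpace (𝓡 4) x) (a : E4),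
          a = mfderiv (𝓡 4) 𝓘(ℝ, E4) ψ x v →
          mfderiv (𝓡 4) 𝓘(ℝ, E4) ψ x (J x v) = WithLp.toLp 2 ![-(a 1), a 0, -(a 3), a 2]) →
      ∀ (X : Type) [TopologicalSpace X] [T2Space X] [SecondCountableTopology X] [CompactSpace X]
        [ConnectedSpace X] [ChartedSpace E4 X] [IsManifold (𝓡 4) ∞ X]
        (ωX : MForm (𝓡 4) X ℝ 2) (JX : AlmostComplexStructure (𝓡 4) ∞ X) (ι : M → X)
        (ηH ηV ηC : E4 → X),
        (IsSmoothForm ωX ∧ IsClosedForm ωX ∧ JX.IsTamedBy ωX) ∧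
        (IsLocalDiffeomorph (𝓡 4) (𝓡 4) ∞ ι ∧ Function.Injective ι ∧
          ∀ (x : M) (v : TangentSpace (𝓡 4) x),
            JX (ι x) (mfderiv (𝓡 4) (𝓡 4) ι x v) = mfderiv (𝓡 4) (𝓡 4) ι x (J x v)) ∧
        (IsLocalDiffeomorphOn 𝓘(ℝ, E4) (𝓡 4) ∞ ηV {p : E4 | p 0 ^ 2 + p 1 ^ 2 < R₁⁻¹ ^ 2} ∧
          Set.InjOn ηV {p : E4 | p 0 ^ 2 + p 1 ^ 2 < R₁⁻¹ ^ 2} ∧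
          (∀ p : E4, p 0 ^ 2 + p 1 ^ 2 < R₁⁻¹ ^ 2 → (p 0 ≠ 0 ∨ p 1 ≠ 0) →
            ηV p = ι (χ (WithLp.toLp 2
              ![p 0 / (p 0 ^ 2 + p 1 ^ 2), -(p 1) / (p 0 ^ 2 + p 1 ^ 2), p 2, p 3]))) ∧
          (∀ p : E4, p 0 = 0 → p 1 = 0 → ηV p ∉ Set.range ι) ∧
          (∀ p : E4, p 0 ^ 2 + p 1 ^ 2 < R₁⁻¹ ^ 2 → ∀ q : E4,
            JX (ηV p) (mfderiv 𝓘(ℝ, E4) (𝓡 4) ηV p q) =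
              mfderiv 𝓘(ℝ, E4) (𝓡 4) ηV p (WithLp.toLp 2 ![-(q 1), q 0, -(q 3), q 2]))) ∧
        (IsLocalDiffeomorphOn 𝓘(ℝ, E4) (𝓡 4) ∞ ηH {p : E4 | p 2 ^ 2 + p 3 ^ 2 < R₁⁻¹ ^ 2} ∧
          Set.InjOn ηH {p : E4 | p 2 ^ 2 + p 3 ^ 2 < R₁⁻¹ ^ 2} ∧
          (∀ p : E4, p 2 ^ 2 + p 3 ^ 2 < R₁⁻¹ ^ 2 → (p 2 ≠ 0 ∨ p 3 ≠ 0) →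
            ηH p = ι (χ (WithLp.toLp 2
              ![p 0, p 1, p 2 / (p 2 ^ 2 + p 3 ^ 2), -(p 3) / (p 2 ^ 2 + p 3 ^ 2)]))) ∧
          (∀ p : E4, p 2 = 0 → p 3 = 0 → ηH p ∉ Set.range ι) ∧
          (∀ p : E4, p 2 ^ 2 + p 3 ^ 2 < R₁⁻¹ ^ 2 → ∀ q : E4,
            JX (ηH p) (mfderiv 𝓘(ℝ, E4) (𝓡 4) ηH p q) =
              mfderiv 𝓘(ℝ, E4) (𝓡 4) ηH p (WithLp.toLp 2 ![-(q 1), q 0, -(q 3), q 2]))) ∧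
        (IsLocalDiffeomorphOn 𝓘(ℝ, E4) (𝓡 4) ∞ ηC
            {p : E4 | p 0 ^ 2 + p 1 ^ 2 < R₁⁻¹ ^ 2 ∧ p 2 ^ 2 + p 3 ^ 2 < R₁⁻¹ ^ 2} ∧
          Set.InjOn ηC {p : E4 | p 0 ^ 2 + p 1 ^ 2 < R₁⁻¹ ^ 2 ∧ p 2 ^ 2 + p 3 ^ 2 < R₁⁻¹ ^ 2} ∧
          (∀ p : E4, p 0 ^ 2 + p 1 ^ 2 < R₁⁻¹ ^ 2 → p 2 ^ 2 + p 3 ^ 2 < R₁⁻¹ ^ 2 →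
            (p 2 ≠ 0 ∨ p 3 ≠ 0) →
            ηC p = ηV (WithLp.toLp 2
              ![p 0, p 1, p 2 / (p 2 ^ 2 + p 3 ^ 2), -(p 3) / (p 2 ^ 2 + p 3 ^ 2)])) ∧
          (∀ p : E4, p 0 ^ 2 + p 1 ^ 2 < R₁⁻¹ ^ 2 → p 2 ^ 2 + p 3 ^ 2 < R₁⁻¹ ^ 2 →
            (p 0 ≠ 0 ∨ p 1 ≠ 0) →
            ηC p = ηH (WithLp.toLp 2
              ![p 0 / (p 0 ^ 2 + p 1 ^ 2), -(p 1) / (p 0 ^ 2 + p 1 ^ 2), p 2, p 3])) ∧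
          ηC 0 ∉ Set.range ι ∧
          (∀ p : E4, p 0 ^ 2 + p 1 ^ 2 < R₁⁻¹ ^ 2 → p 2 ^ 2 + p 3 ^ 2 < R₁⁻¹ ^ 2 → ∀ q : E4,
            JX (ηC p) (mfderiv 𝓘(ℝ, E4) (𝓡 4) ηC p q) =
              mfderiv 𝓘(ℝ, E4) (𝓡 4) ηC p (WithLp.toLp 2 ![-(q 1), q 0, -(q 3), q 2]))) ∧
        (∀ y : X, y ∈ Set.range ι ∨ (∃ p : E4, p 0 ^ 2 + p 1 ^ 2 < R₁⁻¹ ^ 2 ∧ ηV p = y) ∨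
          (∃ p : E4, p 2 ^ 2 + p 3 ^ 2 < R₁⁻¹ ^ 2 ∧ ηH p = y) ∨
          (∃ p : E4, (p 0 ^ 2 + p 1 ^ 2 < R₁⁻¹ ^ 2 ∧ p 2 ^ 2 + p 3 ^ 2 < R₁⁻¹ ^ 2) ∧ ηC p = y)) →
        ∀ (lamV lamH : X → X),
        ContMDiff (𝓡 4) (𝓡 4) ∞ lamV →
        ContMDiff (𝓡 4) (𝓡 4) ∞ lamH →
        (∀ y : X, (∃ p : E4, p 2 = 0 ∧ p 3 = 0 ∧ ηH p = lamV y) ∨ lamV y = ηC 0) →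
        (∀ p : E4, p 2 = 0 → p 3 = 0 → lamV (ηH p) = ηH p) →
        lamV (ηC 0) = ηC 0 →
        (∀ y : X, (∃ q : E4, q 0 = 0 ∧ q 1 = 0 ∧ ηV q = lamH y) ∨ lamH y = ηC 0) →
        (∀ q : E4, q 0 = 0 → q 1 = 0 → lamH (ηV q) = ηV q) →
        lamH (ηC 0) = ηC 0 →
        (∀ y : X, lamV y = ηC 0 ↔ ((∃ q : E4, q 0 = 0 ∧ q 1 = 0 ∧ ηV q = y) ∨ y = ηC 0)) →
        (∀ y : X, lamH y = ηC 0 ↔ ((∃ p : E4, p 2 = 0 ∧ p 3 = 0 ∧ ηH p = y) ∨ y = ηC 0)) →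
        (∀ y y' : X, lamV y = lamV y' → lamH y = lamH y' → y = y') →
        (∀ p q : E4, p 2 = 0 → p 3 = 0 → q 0 = 0 → q 1 = 0 →
          ∃ y : X, lamV y = ηH p ∧ lamH y = ηV q) →
        (∀ (y : X) (v : TangentSpace (𝓡 4) y), mfderiv (𝓡 4) (𝓡 4) lamV y v = 0 →
          mfderiv (𝓡 4) (𝓡 4) lamV y (JX y v) = 0) →
        (∀ (y : X) (v : TangentSpace (𝓡 4) y), mfderiv (𝓡 4) (𝓡 4) lamH y v = 0 →
          mfderiv (𝓡 4) (𝓡 4) lamH y (JX y v) = 0) →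
        (∀ (y : X) (v : TangentSpace (𝓡 4) y), mfderiv (𝓡 4) (𝓡 4) lamV y v = 0 →
          mfderiv (𝓡 4) (𝓡 4) lamH y v = 0 → v = 0) →
        (∀ (y : X) (v : TangentSpace (𝓡 4) y), mfderiv (𝓡 4) (𝓡 4) lamV y v ≠ 0 →
          ∃ α β : ℝ, 0 < β ∧ mfderiv (𝓡 4) (𝓡 4) lamV y (JX y v) =
            α • mfderiv (𝓡 4) (𝓡 4) lamV y v + β • JX (lamV y) (mfderiv (𝓡 4) (𝓡 4) lamV y v)) →
        (∀ (y : X) (v : TangentSpace (𝓡 4) y), mfderiv (𝓡 4) (𝓡 4) lamH y v ≠ 0 →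
          ∃ α β : ℝ, 0 < β ∧ mfderiv (𝓡 4) (𝓡 4) lamH y (JX y v) =
            α • mfderiv (𝓡 4) (𝓡 4) lamH y v + β • JX (lamH y) (mfderiv (𝓡 4) (𝓡 4) lamH y v)) →
        (∀ p q : E4, p 2 = 0 → p 3 = 0 → q 0 = 0 → q 1 = 0 → ηH p ≠ ηV q) →
        (∀ p : E4, p 2 = 0 → p 3 = 0 → ηH p ≠ ηC 0) →
        (∀ q : E4, q 0 = 0 → q 1 = 0 → ηV q ≠ ηC 0) →
        (∀ w : E4, R₁ ^ 2 < w 0 ^ 2 + w 1 ^ 2 → lamV (ι (χ w)) = ηH (WithLp.toLp 2 ![w 0, w 1, 0, 0])) →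
        (∀ w : E4, R₁ ^ 2 < w 2 ^ 2 + w 3 ^ 2 → lamH (ι (χ w)) = ηV (WithLp.toLp 2 ![0, 0, w 2, w 3])) →
        ∃ σ : M ≃ₘ⟮𝓡 4, 𝓡 4⟯ E4,
          (∀ (x : M) (v : TangentSpace (𝓡 4) x) (a b : E4), a = mfderiv (𝓡 4) 𝓘(ℝ, E4) σ x v →
              b = mfderiv (𝓡 4) 𝓘(ℝ, E4) σ x (J x v) →
              (a 2 = 0 → a 3 = 0 → b 2 = 0 ∧ b 3 = 0) ∧ (a 0 = 0 → a 1 = 0 → b 0 = 0 ∧ b 1 = 0)) ∧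
          (∀ (x : M) (v : TangentSpace (𝓡 4) x), v ≠ 0 →
              0 < stdSymplecticForm (mfderiv (𝓡 4) 𝓘(ℝ, E4) σ x v)
                (mfderiv (𝓡 4) 𝓘(ℝ, E4) σ x (J x v))) ∧
          (∀ w : E4, R₁ ^ 2 < w 0 ^ 2 + w 1 ^ 2 → (σ (χ w)) 0 = w 0 ∧ (σ (χ w)) 1 = w 1) ∧
          (∀ w : E4, R₁ ^ 2 < w 2 ^ 2 + w 3 ^ 2 → (σ (χ w)) 2 = w 2 ∧ (σ (χ w)) 3 = w 3) ∧
          (∃ g : E4 → E2, ContDiffOn ℝ ∞ g {p : E4 | p 0 ^ 2 + p 1 ^ 2 < R₁⁻¹ ^ 2} ∧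
            (∀ p q : E4, p 0 ^ 2 + p 1 ^ 2 < R₁⁻¹ ^ 2 → (p 0 ≠ 0 ∨ p 1 ≠ 0) →
              q = σ (χ (WithLp.toLp 2
                ![p 0 / (p 0 ^ 2 + p 1 ^ 2), -(p 1) / (p 0 ^ 2 + p 1 ^ 2), p 2, p 3])) →
              g p = WithLp.toLp 2 ![q 2, q 3]) ∧
            (∀ p : E4, p 0 = 0 → p 1 = 0 → g p = WithLp.toLp 2 ![p 2, p 3])) ∧
          (∃ h : E4 → E2, ContDiffOn ℝ ∞ h {p : E4 | p 2 ^ 2 + p 3 ^ 2 < R₁⁻¹ ^ 2} ∧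
            (∀ p q : E4, p 2 ^ 2 + p 3 ^ 2 < R₁⁻¹ ^ 2 → (p 2 ≠ 0 ∨ p 3 ≠ 0) →
              q = σ (χ (WithLp.toLp 2
                ![p 0, p 1, p 2 / (p 2 ^ 2 + p 3 ^ 2), -(p 3) / (p 2 ^ 2 + p 3 ^ 2)])) →
              h p = WithLp.toLp 2 ![q 0, q 1]) ∧
            (∀ p : E4, p 2 = 0 → p 3 = 0 → h p = WithLp.toLp 2 ![p 0, p 1])) := by
  intro M _ _ _ _ _ _ J K R R₁ ψ χ _ _ _ _ _ hR₁ _ X _ _ _ _ _ _ _ ωX JX ι ηH ηV ηC hW lamV lamH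
    hsV hsH hintoV haxV _ hintoH haxH _ hcorV hcorH hinj hsurj hkerV hkerH htr hholV hholH
    hwHV hwH hwV hfV hfH
  obtain ⟨-, ⟨hιd, hιi, hιJ⟩, ⟨hVd, hVi, hVg, hVa, hVJ⟩, ⟨hHd, hHi, hHg, hHa, hHJ⟩,
    ⟨-, -, hCV, hCH, hC0, -⟩, hcov⟩ := hW
  have H : ReadSigma.SigmaHyp J JX ι ηH ηV ηC χ R₁ lamV lamH :=
    { R₁_pos := hR₁, ι_locDiff := hιd, ι_inj := hιi, ι_J := hιJ,
      ηV_locDiff := hVd, ηV_inj := hVi, ηV_glue := hVg, ηV_axis := hVa, ηV_J := hVJ,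
      ηH_locDiff := hHd, ηH_inj := hHi, ηH_glue := hHg, ηH_axis := hHa, ηH_J := hHJ,
      ηC_V := hCV, ηC_H := hCH, ηC_zero := hC0, cover := hcov,
      lamV_smooth := hsV, lamH_smooth := hsH, lamV_into := hintoV, lamV_axis := haxV,
      lamH_into := hintoH, lamH_axis := haxH, lamV_corner := hcorV, lamH_corner := hcorH,
      inj := hinj, surj := hsurj, kerV := hkerV, kerH := hkerH, trans := htr, holV := hholV,
      holH := hholH, wedge_HV := hwHV, wedge_H := hwH, wedge_V := hwV, flat_V := hfV,
      flat_H := hfH }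
  refine ⟨H.σ, ?_, ?_, ?_, ?_, ?_, ?_⟩
  · intro x v a b ha hb
    rw [H.σ_coe] at ha hb
    exact H.split x v a b ha hb
  · intro x v hv
    rw [H.σ_coe]
    exact H.tame x v hv
  · intro w hw
    rw [H.σ_apply]
    exact H.flat01 w hw
  · intro w hw
    rw [H.σ_apply]
    exact H.flat23 w hw
  · refine ⟨fun p => ReadSigma.T23 (ReadSigma.θV ηV R₁ (lamH (ηV p))), H.contDiffOn_g, ?_, ?_⟩
    · intro p q hp h0 hq
      subst hq
      rw [H.σ_apply]
      exact H.g_off_axis p hp h0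
    · intro p h0 h1
      exact H.g_on_axis p h0 h1
  · refine ⟨fun p => ReadSigma.T01 (ReadSigma.θH ηH R₁ (lamV (ηH p))), H.contDiffOn_h, ?_, ?_⟩
    · intro p q hp h0 hq
      subst hq
      rw [H.σ_apply]
      exact H.h_off_axis p hp h0
    · intro p h2 h3
      exact H.h_on_axis p h2 h3

/-- **Registered helper sub-goal `helper_readSigmaInverseChartHolomorphic`**: the inverse
`invFunOn f s` of an injective local diffeomorphism `f : ℝ⁴ ⊇ s → X`, holomorphic at `p ∈ s` for
`i ⊕ i` and an endomorphism `J₀` of `T_{f p} X`, is `(J₀, i ⊕ i)`-holomorphic at `f p` (holomorphy of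
the inverse cap charts, used in (B2)). [folklore] -/
theorem helper_readSigmaInverseChartHolomorphic : ∀ (X : Type) [TopologicalSpace X]
    [ChartedSpace (EuclideanSpace ℝ (Fin 4)) X] (f : EuclideanSpace ℝ (Fin 4) → X)
    (s : Set (EuclideanSpace ℝ (Fin 4))),
    IsLocalDiffeomorphOn 𝓘(ℝ, EuclideanSpace ℝ (Fin 4)) (𝓡 4) ∞ f s → IsOpen s → Set.InjOn f s →
    ∀ p ∈ s, ∀ J₀ : TangentSpace (𝓡 4) (f p) → TangentSpace (𝓡 4) (f p),
    (∀ q : EuclideanSpace ℝ (Fin 4), J₀ (mfderiv 𝓘(ℝ, EuclideanSpace ℝ (Fin 4)) (𝓡 4) f p q) =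
      mfderiv 𝓘(ℝ, EuclideanSpace ℝ (Fin 4)) (𝓡 4) f p (WithLp.toLp 2 ![-(q 1), q 0, -(q 3), q 2])) →
    ∀ ξ : TangentSpace (𝓡 4) (f p),
    mfderiv (𝓡 4) 𝓘(ℝ, EuclideanSpace ℝ (Fin 4)) (Function.invFunOn f s) (f p) (J₀ ξ) = WithLp.toLp 2
      ![-(WithLp.ofLp (mfderiv (𝓡 4) 𝓘(ℝ, EuclideanSpace ℝ (Fin 4)) (Function.invFunOn f s) (f p) ξ) 1),
        WithLp.ofLp (mfderiv (𝓡 4) 𝓘(ℝ, EuclideanSpace ℝ (Fin 4)) (Function.invFunOn f s) (f p) ξ) 0,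
        -(WithLp.ofLp (mfderiv (𝓡 4) 𝓘(ℝ, EuclideanSpace ℝ (Fin 4)) (Function.invFunOn f s) (f p) ξ) 3),
        WithLp.ofLp (mfderiv (𝓡 4) 𝓘(ℝ, EuclideanSpace ℝ (Fin 4)) (Function.invFunOn f s) (f p) ξ) 2] :=
  fun _ _ _ _ _ hf hs hinj _ hp J₀ hJ ξ =>
    ReadSigma.mfderiv_invFunOn_conj hf hs hinj (by simp) hp CapModel.I4 J₀ hJ ξ

end Summit.SmoothPoincare4.SmoothPoincare4.Theorems.GromovRecognitionRelEnd.CrossCapLaurent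

end
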